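import Mathlib

/-!
# THEOREM F* at the prime levels `3p` (`p ≥ 11`, `p ≠ 13`) — the STATEMENT (count-neutral)

Cell `pub-hfermat` (tree path `Summits/HodgeConjecture/FermatCycles/`), seat prover-1 gen-0, acting on the
COORDINATOR KEEPER RULING of 2026-08-25 (gem sweep H1): the kernel theorem `thmFstar` of the sibling package
`run/shared/lean/pub/pub-hodgefermat/lean/HodgeFermat/` (module `HodgeFermat/DecodingFinal.lean:29`; cell record
`check/DecodingFinal_standalone.lean`, 27 bodies, 454 223 B, sha256 `dca6f17de93119a6…`, hub `lean check` rc 0 —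
`pub-hodgefermat/CERT.md` l.978, GATE HF-G32) was never put through the gate.  This file files its STATEMENT
first, as a `Prop`-valued definition and nothing else; the proof (the minimal import closure of
`DecodingFinal.thmFstar`: `LemmaN`, `ChiThree`, `TwistedMoment`, `LemmaEMu`, `MuEven`, `LemmaENu`, `NuChar`,
`NuOdd`, `NuOddSharp`, `Decoding`, `HurwitzZero` §1–5, `DecodingFinal`) follows in the files
`HodgeFermat*.lean` of this directory, declaration bodies verbatim from the sibling modules, ending in
`theorem HodgeFermat.KRFree.DecodingFinal.thmFstar_holds : ThmFstar`.

THE STATEMENT (`tables/DPRIME-THEOREM.md` §9 of pub-hodgefermat, THEOREM F* at the prime levels).  Let `p ≥ 11`,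
`p ≠ 13` be prime and let `T = (a, b, c)`, `T′ = (a′, b′, c′)` be triples of natural numbers with
`a + b + c ≡ a′ + b′ + c′ ≡ 0 (mod 3p)`, all six entries prime to `p`, and DISJOINT mod `3p` (no entry of `T` is
congruent to an entry of `T′`).  Then `T` and `T′` do not have the same CM type: `H_T ∩ (ℤ/3p)ˣ ≠ H_{T′} ∩ (ℤ/3p)ˣ`,
where `H_T = {t : ⟨ta⟩ + ⟨tb⟩ < 3p}` (`⟨·⟩` = least non-negative residue mod `3p`).  Context: for the Fermat curve
quotients / Fermat varieties of degree `m = 3p` the CM type of the triple `(a, b, c)` is the set `H_T ∩ (ℤ/m)ˣ`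
(Koblitz–Rohrlich 1978); THEOREM F* is the decoding step of the sibling's analysis of the Hodge gap group `G_{3p}`
(DOOR.md §0 of this cell; no claim on general Hodge is made or implied here).

The CM-type MODEL is the sibling's, VERBATIM (`HodgeFermat/LemmaN.lean` l.60–69, namespace
`HodgeFermat.KRFree.LemmaN`: `InH`, `instDecidableInH`, `SameType`); it is declared HERE (and imported, not
re-declared, by `HodgeFermatLemmaNA.lean`) so that the statement file is self-contained.  `p = 13` is a genuine
exception (the level-39 pair `(1, 16, 22) ∼ (2, 5, 32)`), whence `p ≠ 13`.

HONEST FRAMING: explicit algebraic cycles for specific Hodge classes on Fermat/Delsarte varieties; residual open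
instances listed; no claim on general Hodge.  No `sorry`; `Prop`-valued definitions only (count-neutral).
-/

set_option autoImplicit false

namespace HodgeFermat.KRFree.LemmaN

/-- `t ∈ H_T` for `T = (a, b, c)` of level `N`: `⟨ta⟩_N + ⟨tb⟩_N < N` -/
def InH (N : ℕ) (T : ℕ × ℕ × ℕ) (t : ℕ) : Prop :=
  (t * T.1) % N + (t * T.2.1) % N < N

/-- `InH N T t` is decidable (it is a numeric inequality); the sibling package's kernel instances use this. -/
instance instDecidableInH (N : ℕ) (T : ℕ × ℕ × ℕ) (t : ℕ) : Decidable (InH N T t) :=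
  inferInstanceAs (Decidable ((t * T.1) % N + (t * T.2.1) % N < N))

/-- same CM type: `H_T ∩ (ℤ/N)ˣ = H_{T'} ∩ (ℤ/N)ˣ` -/
def SameType (N : ℕ) (T T' : ℕ × ℕ × ℕ) : Prop :=
  ∀ t, Nat.Coprime t N → (InH N T t ↔ InH N T' t)

end HodgeFermat.KRFree.LemmaN

namespace HodgeFermat.KRFree.DecodingFinal

open HodgeFermat.KRFree.LemmaN

/-- **THEOREM F\* at the prime levels — the statement.**  For every prime `p ≥ 11`, `p ≠ 13`, and all zero-sum
triples `(a, b, c)`, `(a′, b′, c′)` mod `3p` with all entries prime to `p` that are DISJOINT mod `3p` (no entry of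
the first congruent to an entry of the second), the two triples do not have the same CM type
(`LemmaN.SameType (3p)`).  This is LITERALLY the universal closure of the signature of the sibling package's
`HodgeFermat.KRFree.DecodingFinal.thmFstar` (`DecodingFinal.lean:29`); proved in `HodgeFermatThmFstar.lean` as
`thmFstar_holds`.  (pub-hodgefermat `tables/DPRIME-THEOREM.md` §9; CERT.md l.978.) -/
def ThmFstar : Prop :=
  ∀ ⦃p : ℕ⦄, p.Prime → 11 ≤ p → p ≠ 13 → ∀ ⦃a b c a' b' c' : ℕ⦄,
    3 * p ∣ a + b + c → 3 * p ∣ a' + b' + c' →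
    Nat.Coprime a p → Nat.Coprime b p → Nat.Coprime c p →
    Nat.Coprime a' p → Nat.Coprime b' p → Nat.Coprime c' p →
    (∀ u v, (u = a ∨ u = b ∨ u = c) → (v = a' ∨ v = b' ∨ v = c') → ¬ u ≡ v [MOD 3 * p]) →
    ¬ SameType (3 * p) (a, b, c) (a', b', c')

end HodgeFermat.KRFree.DecodingFinal
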